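import Summits.BirchSwinnertonDyer.Rank1Residual.O5.CoordinateLagrangianLemma
import HarnessLib

/-!
# The `ℤ/p^k` swap at one hyperbolic place — o5-r2 GEN 15 docket (b) for cc-eng-5
# (`HOME/b2b-bsdres-o5-r2/gen15/O5-NONIWASAWA-LEDGER.md` §(α) row "depth law k ≥ 2" / Recommendation 3:
#  "ℤ/3^k swap lemma over ZMod (3^k) — the last (α) piece behind R1♯ clauses (B)–(E)";
#  `gen15/R1SHARP-DERIVATION.md` §3 (★), (c), (d); cell `b2b-bsdres`, lane CLASS-CLOSURE; cc-eng-5 GEN 43)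

HONEST FRAMING (cell `b2b-bsdres`, run/shared/lean/b2b/bsd-rank1-residual/, verbatim in every file):
the goal of the cell is to DELETE the COMBINATION-SHAPED residual classes of the Birch–Swinnerton-Dyer
formula for ALL analytic-rank `≤ 1` elliptic curves over `ℚ` — "full BSD formula for every rank `≤ 1`
curve in class `C`" assembled STRICTLY from published theorems — so that the rank-`≤ 1` remainder
becomes exactly the CONSTRUCTION-SHAPED classes, which are TYPED (missing-input `Prop`s), NOT
attempted. This is not "finishing BSD". This file: THEOREMS ONLY (no definition, no named fact, no
`@[conjecture]` node, no `sorry`; net named-fact debt `0`), PURE ALGEBRA over `ZMod (p ^ k)` on the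
vocabulary of `O5/CoordinateLagrangianLemma.lean` (S1, `coordSubgroup`). The ARITHMETIC reading — `H =
H¹(ℚ, C[3^k])`, `locq` = localisation at a level-raising (Kolyvagin) prime `q ≡ 2 (mod 3)` into
`H¹(ℚ_q, T) = F_q ⊕ F'_q`, `S = Sel^{rel}`, the two hypotheses = Poitou–Tate reciprocity (isotropy) and
the Wiles / DDT 2.19 count (`#loc_q(Sel^{rel}) = 3^k`) — is NOT asserted here; it is the planner's
THEOREM-CANDIDATE / EVIDENCE material (`DepthLawThree`, DEPTH9 prereg 984c8351acfdff92). Nothing is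
booked; no mark of `RESIDUAL-MAP.md` moves; O5 stays OPEN.

## What is proved
With `R = ZMod (p^k)`, `p` an odd prime, `k ≥ 1`, `H` an abelian group, `locq : H →+ R × R`,
`S ≤ H`, and the hypotheses "`locq(S)` is totally isotropic for `x y' + x' y`" and "`#locq(S) = p^k`":
* `swap`: there is `δ ≤ k` with `locq(S) = C_δ = p^δ R × p^(k-δ) R` (S1), hence
  `locq(S ∩ locq⁻¹(R × 0)) = p^δ R × 0`, `locq(S ∩ locq⁻¹(0 × R)) = 0 × p^(k-δ) R`, and the indices
  `[Sel_X : Sel_str] = p^(k-δ)`, `[Sel_Y : Sel_str] = p^δ`, `[S : Sel_str] = p^k`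
  (`Sel_X`, `Sel_Y` = the subgroups of `S` with local condition `R × 0`, resp. the SWITCHED condition
  `0 × R`; `Sel_str = S ∩ ker locq`; indices as `(ker locq).relIndex _`).
* `swap_relIndex_mul`: `[Sel_X : Sel_str] · [Sel_Y : Sel_str] = p^k`.
* `swap_of_card_fst`: if `[Sel_X : Sel_str] = p^(k-d)` (`d ≤ k`; "the depth `d` read on `C`") then
  `locq(S) = C_d` and `[Sel_Y : Sel_str] = p^d` — R1♯ §3 (c)–(d) "`δ = d`" in the abstract.
* small tools: `coordSubgroup_inf_fst/snd`, `card_zmultiples_pow_prod_bot`, `card_bot_prod_zmultiples_pow`,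
  `map_inf_comap_eq`.
What is deliberately NOT here: the level-by-level bookkeeping (★★) and the Cassels–Tate increments
(clauses (A)–(E)) — pure combinatorics on top of this file (S2 of the derivation); the Galois-cohomological
instantiation (S3–S5: Tate curve at `q`, PT sum formula, DDT 2.19, matching off `q`, H5 at an additive `3`).
-/

namespace Summit.BirchSwinnertonDyer.Rank1Residual.O5

/-! ## The `ℤ/p^k` swap (o5-r2 GEN 15 docket (b); `R1SHARP-DERIVATION.md` §3 (★), (c), (d)) -/

namespace CoordinateLagrangian

variable {p k : ℕ}

/-- `C_δ ∩ (R × 0) = p^δ R × 0`. [folklore] -/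
theorem coordSubgroup_inf_fst (p k δ : ℕ) :
    coordSubgroup p k δ ⊓ (⊤ : AddSubgroup (ZMod (p ^ k))).prod ⊥ =
      (AddSubgroup.zmultiples ((p ^ δ : ℕ) : ZMod (p ^ k))).prod ⊥ := by
  ext x
  simp only [coordSubgroup, AddSubgroup.mem_inf, AddSubgroup.mem_prod, AddSubgroup.mem_top,
    AddSubgroup.mem_bot, true_and]
  constructor
  · rintro ⟨⟨h1, -⟩, h2⟩
    exact ⟨h1, h2⟩
  · rintro ⟨h1, h2⟩
    exact ⟨⟨h1, by rw [h2]; exact zero_mem _⟩, h2⟩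

/-- `C_δ ∩ (0 × R) = 0 × p^(k-δ) R`. [folklore] -/
theorem coordSubgroup_inf_snd (p k δ : ℕ) :
    coordSubgroup p k δ ⊓ (⊥ : AddSubgroup (ZMod (p ^ k))).prod ⊤ =
      (⊥ : AddSubgroup (ZMod (p ^ k))).prod
        (AddSubgroup.zmultiples ((p ^ (k - δ) : ℕ) : ZMod (p ^ k))) := by
  ext x
  simp only [coordSubgroup, AddSubgroup.mem_inf, AddSubgroup.mem_prod, AddSubgroup.mem_top,
    AddSubgroup.mem_bot, and_true]
  constructor
  · rintro ⟨⟨-, h2⟩, h1⟩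
    exact ⟨h1, h2⟩
  · rintro ⟨h1, h2⟩
    exact ⟨⟨by rw [h1]; exact zero_mem _, h2⟩, h1⟩

/-- `#(p^j R × 0) = p^(k-j)` for `j ≤ k`. [folklore] -/
theorem card_zmultiples_pow_prod_bot (hp : p.Prime) {j : ℕ} (hj : j ≤ k) :
    Nat.card ((AddSubgroup.zmultiples ((p ^ j : ℕ) : ZMod (p ^ k))).prod
      (⊥ : AddSubgroup (ZMod (p ^ k)))) = p ^ (k - j) := by
  rw [Nat.card_congr (AddSubgroup.prodEquiv _ _).toEquiv, Nat.card_prod, card_zmultiples_pow hp hj,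
    AddSubgroup.card_bot, mul_one]

/-- `#(0 × p^j R) = p^(k-j)` for `j ≤ k`. [folklore] -/
theorem card_bot_prod_zmultiples_pow (hp : p.Prime) {j : ℕ} (hj : j ≤ k) :
    Nat.card ((⊥ : AddSubgroup (ZMod (p ^ k))).prod
      (AddSubgroup.zmultiples ((p ^ j : ℕ) : ZMod (p ^ k)))) = p ^ (k - j) := by
  rw [Nat.card_congr (AddSubgroup.prodEquiv _ _).toEquiv, Nat.card_prod, card_zmultiples_pow hp hj,
    AddSubgroup.card_bot, one_mul]

/-- `f(S ∩ f⁻¹ T) = f(S) ∩ T` for additive subgroups. [folklore] -/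
theorem map_inf_comap_eq {H G : Type*} [AddCommGroup H] [AddCommGroup G] (f : H →+ G)
    (S : AddSubgroup H) (T : AddSubgroup G) : (S ⊓ T.comap f).map f = S.map f ⊓ T := by
  apply SetLike.coe_injective
  simp only [AddSubgroup.coe_map, AddSubgroup.coe_inf, AddSubgroup.coe_comap]
  exact Set.image_inter_preimage f S T

/-- **THE `ℤ/p^k` SWAP** (o5-r2 GEN 15 docket (b): "a `ℤ/3^k` version of the swap"; the abstract
form of `R1SHARP-DERIVATION.md` §3 (★) and (c)–(d)). Let `p` be an odd prime, `k ≥ 1`,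
`R = ZMod (p^k)`, `H` any abelian group ("`H¹(ℚ, T)`"), `locq : H →+ R × R` ("localisation at the
level-raising prime `q`, `H¹(ℚ_q, T) = F_q ⊕ F'_q`") and `S ≤ H` ("the relaxed Selmer group
`Sel^{rel}`: the common conditions off `q`, none at `q`"). ASSUME the two outputs of global duality,
taken here as hypotheses: `A := locq(S)` is totally isotropic for the hyperbolic pairing (reciprocity /
sum formula) and `#A = p^k` (Wiles–DDT 2.19). THEN, by S1, `A = C_δ = p^δ R × p^(k-δ) R` for some
`δ ≤ k`, and consequently, for the two Selmer groups `Sel_X := S ∩ locq⁻¹(R × 0)` (condition `F_q`,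
"`Sel_{p^k}(C)`") and `Sel_Y := S ∩ locq⁻¹(0 × R)` (condition `F'_q`, "`Sel_{p^k}(G)`", the SWITCHED
condition) and the strict one `ker locq ∩ S`: `locq(Sel_X) = p^δ R × 0` (order `p^(k-δ)`),
`locq(Sel_Y) = 0 × p^(k-δ) R` (order `p^δ`), i.e. `[Sel_X : Sel_str] = p^(k-δ)`,
`[Sel_Y : Sel_str] = p^δ`, `[S : Sel_str] = p^k` (indices written as `(ker locq).relIndex _`;
`Sel_str = S ∩ ker locq` by `AddSubgroup.inf_relIndex_right`). Pure algebra; the arithmetic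
identifications in quotes are NOT asserted. [folklore] -/
theorem swap {H : Type*} [AddCommGroup H] (hp : p.Prime) (hp2 : p ≠ 2) (hk : 1 ≤ k)
    (locq : H →+ ZMod (p ^ k) × ZMod (p ^ k)) (S : AddSubgroup H)
    (hiso : IsIsotropicSubgroup (p ^ k) (S.map locq)) (hcard : Nat.card (S.map locq) = p ^ k) :
    ∃ δ, δ ≤ k ∧ S.map locq = coordSubgroup p k δ ∧
      (S ⊓ ((⊤ : AddSubgroup (ZMod (p ^ k))).prod ⊥).comap locq).map locq =
        (AddSubgroup.zmultiples ((p ^ δ : ℕ) : ZMod (p ^ k))).prod ⊥ ∧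
      (S ⊓ ((⊥ : AddSubgroup (ZMod (p ^ k))).prod ⊤).comap locq).map locq =
        (⊥ : AddSubgroup (ZMod (p ^ k))).prod
          (AddSubgroup.zmultiples ((p ^ (k - δ) : ℕ) : ZMod (p ^ k))) ∧
      locq.ker.relIndex (S ⊓ ((⊤ : AddSubgroup (ZMod (p ^ k))).prod ⊥).comap locq) = p ^ (k - δ) ∧
      locq.ker.relIndex (S ⊓ ((⊥ : AddSubgroup (ZMod (p ^ k))).prod ⊤).comap locq) = p ^ δ ∧
      locq.ker.relIndex S = p ^ k := by
  obtain ⟨δ, hδ, hA⟩ := coordinateLagrangian_of_odd hp hp2 hk (S.map locq) hiso hcard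
  have hAeq : S.map locq = coordSubgroup p k δ := (isCoordinate_iff_eq p k δ _).1 hA
  have hX : (S ⊓ ((⊤ : AddSubgroup (ZMod (p ^ k))).prod ⊥).comap locq).map locq =
      (AddSubgroup.zmultiples ((p ^ δ : ℕ) : ZMod (p ^ k))).prod ⊥ := by
    rw [map_inf_comap_eq, hAeq, coordSubgroup_inf_fst]
  have hY : (S ⊓ ((⊥ : AddSubgroup (ZMod (p ^ k))).prod ⊤).comap locq).map locq =
      (⊥ : AddSubgroup (ZMod (p ^ k))).prod
        (AddSubgroup.zmultiples ((p ^ (k - δ) : ℕ) : ZMod (p ^ k))) := by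
    rw [map_inf_comap_eq, hAeq, coordSubgroup_inf_snd]
  refine ⟨δ, hδ, hAeq, hX, hY, ?_, ?_, ?_⟩
  · rw [AddSubgroup.relIndex_ker, hX, card_zmultiples_pow_prod_bot hp hδ]
  · rw [AddSubgroup.relIndex_ker, hY, card_bot_prod_zmultiples_pow hp (Nat.sub_le k δ),
      Nat.sub_sub_self hδ]
  · rw [AddSubgroup.relIndex_ker, hcard]

/-- The swap, PRODUCT FORM: `[Sel_X : Sel_str] · [Sel_Y : Sel_str] = p^k = [S : Sel_str]` — the
`ℤ/p^k` replacement for "the two Selmer dimensions differ by the switch at one Lagrangian".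
[folklore] -/
theorem swap_relIndex_mul {H : Type*} [AddCommGroup H] (hp : p.Prime) (hp2 : p ≠ 2) (hk : 1 ≤ k)
    (locq : H →+ ZMod (p ^ k) × ZMod (p ^ k)) (S : AddSubgroup H)
    (hiso : IsIsotropicSubgroup (p ^ k) (S.map locq)) (hcard : Nat.card (S.map locq) = p ^ k) :
    locq.ker.relIndex (S ⊓ ((⊤ : AddSubgroup (ZMod (p ^ k))).prod ⊥).comap locq) *
      locq.ker.relIndex (S ⊓ ((⊥ : AddSubgroup (ZMod (p ^ k))).prod ⊤).comap locq) = p ^ k := by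
  obtain ⟨δ, hδ, -, -, -, hx, hy, -⟩ := swap hp hp2 hk locq S hiso hcard
  rw [hx, hy, ← pow_add, Nat.sub_add_cancel hδ]

/-- The swap READ FROM THE `X` SIDE (`R1SHARP-DERIVATION.md` §3 (c)–(d): "`δ = d`"): if the image
of `Sel_X` at `q` has order `p^(k-d)` (`d ≤ k`; arithmetically: the Mordell–Weil depth `d` of `C` at
`q`, `loc_q(C(ℚ)/p^k) ≅ ℤ/p^(k-d)`), then `locq(S) = C_d` and `[Sel_Y : Sel_str] = p^d`.
[folklore] -/
theorem swap_of_card_fst {H : Type*} [AddCommGroup H] (hp : p.Prime) (hp2 : p ≠ 2) (hk : 1 ≤ k)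
    (locq : H →+ ZMod (p ^ k) × ZMod (p ^ k)) (S : AddSubgroup H)
    (hiso : IsIsotropicSubgroup (p ^ k) (S.map locq)) (hcard : Nat.card (S.map locq) = p ^ k)
    {d : ℕ} (hd : d ≤ k)
    (hXcard : locq.ker.relIndex (S ⊓ ((⊤ : AddSubgroup (ZMod (p ^ k))).prod ⊥).comap locq) =
      p ^ (k - d)) :
    S.map locq = coordSubgroup p k d ∧
      locq.ker.relIndex (S ⊓ ((⊥ : AddSubgroup (ZMod (p ^ k))).prod ⊤).comap locq) = p ^ d := by
  obtain ⟨δ, hδ, hA, -, -, hx, hy, -⟩ := swap hp hp2 hk locq S hiso hcard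
  have hδd : δ = d := by
    have h := Nat.pow_right_injective hp.two_le (hx.symm.trans hXcard)
    omega
  subst hδd
  exact ⟨hA, hy⟩

end CoordinateLagrangian

end Summit.BirchSwinnertonDyer.Rank1Residual.O5
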